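import Summits.Ventures.PercRepro.RankLevelSetExplicitLin2KeyCube

/-!
# PercRepro — THE CUBE KEY ROW AT `(q, p) = (15, 126 174)`, PART A: chunks 1 … 4 of 8 (p9, S4)

`proofs/SUBCLAIM-S4-p9.md` §S4.2⁗‴. The cube key `KeyC 15 126174 d` (RankLevelSetExplicitLin2KeyCube) at the coranks
`16 … 16399` of the level-15 row at `p = 126 174`, by the kernel (`decide`, four chunks of
4 096); the row is assembled in RankLevelSetExplicitLin2CubeRowFifteen. Axioms: standard.
-/

namespace PercRepro

namespace ThmN

namespace Explicit

/-- The cube key row at `(q, p) = (15, 126 174)`, chunk 1 of 8: coranks `16 … 4111`, by the kernel. -/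
theorem key_fifteen_cube_row_1 : ∀ t < 4096, KeyC 15 126174 (16 + t) := by decide +kernel

/-- The cube key row at `(q, p) = (15, 126 174)`, chunk 2 of 8: coranks `4112 … 8207`, by the kernel. -/
theorem key_fifteen_cube_row_2 : ∀ t < 4096, KeyC 15 126174 (16 + (4096 + t)) := by decide +kernel

/-- The cube key row at `(q, p) = (15, 126 174)`, chunk 3 of 8: coranks `8208 … 12303`, by the kernel. -/
theorem key_fifteen_cube_row_3 : ∀ t < 4096, KeyC 15 126174 (16 + (8192 + t)) := by decide +kernel

/-- The cube key row at `(q, p) = (15, 126 174)`, chunk 4 of 8: coranks `12304 … 16399`, by the kernel. -/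
theorem key_fifteen_cube_row_4 : ∀ t < 4096, KeyC 15 126174 (16 + (12288 + t)) := by decide +kernel

end Explicit

end ThmN

end PercRepro
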